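import Literature.Computability.Cryptography.LWEPrimePowerNoiseSum
import Literature.Computability.Cryptography.LWENoiseRateGrid
import Literature.Computability.Cryptography.StatisticalDistanceMixtures
import HarnessLib

/-!
# Aggregating input samples: the sum of `K` LWE samples, and the distinguisher's advantage under a nearby noise law (MP12 Thm. 3.1, first step)

Topic `Computability/Cryptography` (LWE), grouping namespace `LWE.MP12`, sequel of
`LWEPrimePowerNoiseSum.lean` (`sumNoise χ K`, the `K`-fold sum of noises, and
`tvDist_sumNoise_discretizedGaussian_le`) and `LWEPrimePowerHybrids.lean` (`lweSample_bind_add`).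
Proved material (no named fact) towards
`Literature.Computability.Cryptography.blprs_gapSVP_sqrt_dim_to_lwe_classical` (**pqc.S21**), component
Thm. 2.17 = Micciancio–Peikert 2012, Thm. 3.1 (hypothesis `h₂` of `BLPRSReduction.…_of_components`), first
step of the printed proof (ePrint 2011/501, p. 15: "transform `A_{s,α}` into `A_{s,α'}`"), realised by
summing `K` input samples:

* `sumSamples`, **`iidPMF_lweSample_map_sumSamples`** — the coordinatewise sum of `K + 1` independent
  samples of `A_{s,χ}` is ONE sample of `A_{s, sumNoise χ (K+1)}` (uniform `a`-parts add to a uniform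
  vector; `addConv_comm`).
* **`abs_acceptProb_toReal_sub_le_tvDist`**, **`abs_distinguishingAdvantage_sub_le`** — a distinguisher's
  acceptance probability / average-case advantage moves by at most `Δ` / `m·Δ(χ, χ')` when the noise law
  moves by `Δ(χ, χ')` (so the hypothesis of `h₂`, an advantage against `Ψ̄_{rate₂}`, transfers to the
  aggregated noise `sumNoise Ψ̄_{rate₁} K` up to `m(K-1)/(2Q·rate₁)`:
  **`distinguishingAdvantage_sumNoise_ge`**).

## References

* D. Micciancio, C. Peikert, *Trapdoors for lattices: simpler, tighter, faster, smaller*, EUROCRYPT 2012;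
  full version IACR ePrint 2011/501, §3, proof of Thm. 3.1, p. 15 (first step). [MicciancioPeikert2012]
* O. Regev, *On lattices, learning with errors, random linear codes, and cryptography*, J. ACM 56
  (2009), §4 (average-case decision LWE). [RegevLWE2009]
-/

noncomputable section

open scoped ENNReal

namespace Literature.Computability.Cryptography

namespace LWE

namespace MP12

/-! ### The sum of independent LWE samples -/

section Sum

variable {ι : Type} [Fintype ι] [DecidableEq ι] {Q : ℕ} [NeZero Q]

/-- The coordinatewise sum of a tuple of samples. [cite: MicciancioPeikert2012, Thm. 3.1 proof (p. 15, first step)] -/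
def sumSamples {K : ℕ} (v : Fin K → (ι → ZMod Q) × ZMod Q) : (ι → ZMod Q) × ZMod Q := ∑ k, v k

omit [NeZero Q] in
/-- Additive convolution is commutative. [folklore] -/
theorem addConv_comm {R : Type} [CommRing R] [Fintype R] (χ₁ χ₂ : PMF R) : addConv χ₁ χ₂ = addConv χ₂ χ₁ := by
  unfold addConv
  rw [show (fun e₁ => χ₂.map fun e₂ => e₁ + e₂) = fun e₁ => χ₂.bind fun e₂ => PMF.pure (e₁ + e₂) from rfl,
    PMF.bind_comm]
  refine congrArg _ (funext fun e₂ => ?_)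
  change (χ₁.bind fun e₁ => PMF.pure (e₁ + e₂)) = χ₁.map fun e₁ => e₂ + e₁
  simp_rw [add_comm]
  rfl

/-- **The sum of `K + 1` independent samples of `A_{s,χ}` is a sample of `A_{s, χ^{⋆(K+1)}}`.**
[cite: MicciancioPeikert2012, Thm. 3.1 proof (p. 15, first step)] -/
theorem iidPMF_lweSample_map_sumSamples (χ : PMF (ZMod Q)) (s : ι → ZMod Q) :
    ∀ K : ℕ, (iidPMF (lweSample χ s) (K + 1)).map sumSamples = lweSample (sumNoise Q χ (K + 1)) s
  | 0 => by
    rw [sumNoise_one, iidPMF_succ, iidPMF_zero, PMF.map_bind]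
    have h : ∀ x : (ι → ZMod Q) × ZMod Q,
        (((PMF.pure Fin.elim0).map fun v => (Fin.cons x v : Fin 1 → (ι → ZMod Q) × ZMod Q)).map sumSamples) = PMF.pure x := by
      intro x
      rw [PMF.pure_map, PMF.pure_map]
      congr 1
      simp [sumSamples]
    simp_rw [h]
    exact PMF.bind_pure _
  | K + 1 => by
    rw [iidPMF_succ, PMF.map_bind, sumNoise_succ, addConv_comm, ← lweSample_bind_add,
      ← iidPMF_lweSample_map_sumSamples χ s K]
    refine congrArg _ (funext fun x => ?_)
    rw [PMF.map_comp, PMF.map_comp]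
    congr 1
    funext v
    simp only [Function.comp_apply, sumSamples, Fin.sum_univ_succ, Fin.cons_zero, Fin.cons_succ]

end Sum

/-! ### Acceptance probabilities and advantages under a nearby noise law -/

section Advantage

variable {β : Type}

/-- **An acceptance probability moves by at most the statistical distance of the input law.**
[folklore] -/
theorem abs_acceptProb_toReal_sub_le_tvDist (D : β → PMF Bool) (P P' : PMF β) :
    |(acceptProb D P).toReal - (acceptProb D P').toReal| ≤ P.tvDist P' := by
  unfold acceptProb
  rw [← PMF.toOuterMeasure_apply_singleton (P.bind D) true, ← PMF.toOuterMeasure_apply_singleton (P'.bind D) true]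
  exact (PMF.abs_toReal_toOuterMeasure_sub_le_tvDist _ _ {true}).trans (PMF.tvDist_bind_left_le P P' D)

variable {ι : Type} [Fintype ι] [DecidableEq ι] {R : Type} [CommRing R] [Fintype R]

/-- The LWE branches with a uniform secret are `m·Δ(χ, χ')`-close for `Δ(χ, χ')`-close noise laws.
[cite: RegevLWE2009, Lemma 3.7 (proof)] -/
theorem tvDist_lweSamplesUniformSecret_le (χ χ' : PMF R) (m : ℕ) :
    (lweSamplesUniformSecret (ι := ι) χ m).tvDist (lweSamplesUniformSecret χ' m) ≤ m * χ.tvDist χ' := by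
  unfold lweSamplesUniformSecret
  exact PMF.tvDist_bind_le_of_forall_le _ _ _ fun s => tvDist_lweSamples_le χ χ' s m

/-- **The average-case advantage moves by at most `m·Δ(χ, χ')`** when the noise law moves.
[cite: RegevLWE2009, §4 (average-case decision LWE)] -/
theorem abs_distinguishingAdvantage_sub_le (χ χ' : PMF R) (m : ℕ) (D : Distinguisher ι R m) :
    |distinguishingAdvantage χ m D - distinguishingAdvantage χ' m D| ≤ m * χ.tvDist χ' := by
  unfold distinguishingAdvantage
  refine (abs_abs_sub_abs_le_abs_sub _ _).trans ?_
  rw [show (acceptProb D (lweSamplesUniformSecret χ m)).toReal - (acceptProb D (uniformSamples ι R m)).toReal -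
      ((acceptProb D (lweSamplesUniformSecret χ' m)).toReal - (acceptProb D (uniformSamples ι R m)).toReal) =
      (acceptProb D (lweSamplesUniformSecret χ m)).toReal - (acceptProb D (lweSamplesUniformSecret χ' m)).toReal by ring]
  exact (abs_acceptProb_toReal_sub_le_tvDist D _ _).trans (tvDist_lweSamplesUniformSecret_le χ χ' m)

/-- **The hypothesis of `h₂` transfers to the aggregated noise**: the advantage against
`A_{·, sumNoise Ψ̄_α K}` is at least the advantage against `A_{·, Ψ̄_{√K α}}` minus `m(K-1)/(2Qα)`.
[cite: MicciancioPeikert2012, Thm. 3.1 proof (p. 15, first step), discrete model] -/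
theorem distinguishingAdvantage_sumNoise_ge {n Q : ℕ} [NeZero Q] {α : ℝ} (hα : 0 < α) {K : ℕ} (hK : 1 ≤ K) (m : ℕ)
    (D : Distinguisher (Fin n) (ZMod Q) m) :
    distinguishingAdvantage (discretizedGaussian Q (Real.sqrt K * α)) m D - m * ((K - 1 : ℝ) / (2 * Q * α)) ≤
      distinguishingAdvantage (sumNoise Q (discretizedGaussian Q α) K) m D := by
  have h := abs_distinguishingAdvantage_sub_le (ι := Fin n) (sumNoise Q (discretizedGaussian Q α) K)
    (discretizedGaussian Q (Real.sqrt K * α)) m D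
  have ht := tvDist_sumNoise_discretizedGaussian_le Q hα K hK
  rw [abs_le] at h
  nlinarith [h.1, mul_le_mul_of_nonneg_left ht (Nat.cast_nonneg m)]

end Advantage

end MP12

end LWE

end Literature.Computability.Cryptography

end
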